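import Summits.QuantumFields.QCD.Theses.NestedDissectionSea
import Literature.MathematicalPhysics.QuantumLattice.WilsonPositivityDomain

/-!
# Disproof work file for the crux `EarlyCrosserLaw` (stmt-QuantumFields-13995) — findings

Standing adversary (cdisprove seat `refuter-cdisprove-stmt-QuantumFields-13995-0`) on
`Summit.QuantumFields.QCD.Theses.NestedDissectionSea.EarlyCrosserLaw`
(∃ ONE admissible regularisation, M₀, b₀, ℓ, ∀ m > M₀ ∃ R with (a′) window dilution of EARLY
CROSSERS — a Dirichlet cell of a window box, or one of its 16 children, singular at a bare mass
`μ' ≥ m_f(k)` — (b) the LOWER parity pin and (b″) the UPPER parity pin).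

## Verdict so far: NO KILL.  Everything conclusive below is `sorry`-free.

* **Formal exits are closed** (confirming refuters g47-0 / rattack-13978 / rattack-13995, now with
  hypothesis-free Lean backing): § 1 proves the Dirichlet-cell positivity domain
  (`det_toSquareBlockProp_wilsonDirac_ne_zero`: at bare mass `μ > 0` NO principal submatrix of
  `D_W(U, μ, 1)` is singular, any gauge field, any index set — numerical range
  `Re⟨v, D_W v⟩ ≥ μ‖v‖²`, `re_quadForm_wilsonDirac_ge`), and § 2 uses it with the tree's Seiler
  positivity (`fermionDet_wilsonDirac_re_pos`) to show that the crux WITH THE LOWER PIN (b) DELETED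
  is a THEOREM (`trivial_without_lowerPin`, junk witness `m_crit ≡ 1`): the lower pin (b) is the
  only content-bearing clause — any proof must use it, any disproof must go through a regime where
  (b) holds.  § 3: (b) alone forces the line to be non-positive in lattice units eventually
  (`lowerPin_forces_mcrit_le`), i.e. the valence threshold `-m_f(k)` of (a′) is `≥ -a_k(M₀+)/Z_m`.
* **No U-independent early crosser** (§ 4, `wilsonCell_two_det_eq_zero_iff`): the only
  gauge-field-independent singular bare mass of a Dirichlet cell is `μ' = -4` (one-site cells
  `s = (2,2,2,2)`, proved; needles, whose massless operator is `4 + nilpotent`, on paper); it bites (a′) only if `m_f(k) ≤ -4`, excluded for every witness obeying (b)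
  near the physical line (`m_crit(β) ∈ (-2, 0)`).  Hence `¬EarlyCrosserLaw` needs a quantitative
  LOWER bound on a phase-quenched SU(3) probability, uniformly in `k` — not available in the tree
  (recorded, not attempted: it is the substance of the crux).
* **Physics-level attack (why it resists)**: an early crosser is a REAL eigenvalue `λ` of the
  massless Dirichlet cell operator with `λ ≤ |m_crit(β_k)| - a_k m/Z_m → 0⁺`; by the kinetic edge
  the carrier has lattice size `≥ π(2/λ)^{1/2} ≍ 2.75 β_W^{1/2} → ∞`, so every FIXED-shape
  dislocation drops out eventually, smooth extended carriers need an (approximate) zero mode of the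
  continuum Dirac operator (topology, action → 8π²/g² : exponent b = 11 - 2N_f/3 > 4 beats the
  a⁻⁴ entropy), and Lifshitz cold spots cost a Gaussian exponent ≍ 10³/g₀⁴ ≫ ln(ℓ/a)⁴ ≍ β/b₀.
  The one place the heuristic is thin: NON-topological, NON-smooth carriers of intermediate size
  `s_free(β) … ρ_*` in the kinematic window `[E₀(-Δ_U/2), |m_c|]` (non-perturbatively wide at
  β_W = 6: ≈ [0.5, 0.82]); no construction of a sub-threshold-action carrier is known to this seat,
  and the data (Mohler–Schaefer 2020: ⟨n_neg⟩ ∝ a^{6.8} per fixed physical volume) point the other way.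
* **Literature** (read this seat): Bardeen–Duncan–Eichten–Thacker, PRD 57 (1998) 1633
  (hep-lat/9705008) p. 4: the shifts of the real Wilson–Dirac eigenvalues "are lattice artifacts …
  expected to disappear in the continuum limit; for larger β the distribution becomes more sharply
  peaked", p. 10: "for larger values of β, a smaller number of configurations should be affected at
  fixed physical volume" (= (a′)/(b″) qualitatively; clover improvement does NOT narrow the spread);
  Golterman–Shamir–Svetitsky PRD 72 (2005) 034501 (hep-lat/0503037) §7: localized near-zero modes
  of the SUPERcritical H_W come from small dislocations, suppressed by rectangle terms — deep below
  the line, i.e. LATE crossers, irrelevant to (a′); Mohler–Schaefer 2020: ⟨n_neg⟩ 2% → 0.05% at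
  fixed (3 fm)⁴ for a = 0.086 → 0.050 fm (∝ a^{6.8}).  No printed claim that early crossers persist
  per physical volume was found (searchd rc 75 this session; galaxy + arXiv direct reads).
* **Numerics** (§ 6): E1 (j009326) — the free Dirichlet cell has NO real eigenvalue except the symmetry-pinned
  `λ = 4` of even-sided boxes (§ 4b); UV noise / Haar links create real eigenvalues only in mid-band pairs `[2.25, 5.75]`
  and push the spectral left edge UP; chirality = 1/κ confirmed.  E2 (j009328/j009330, β_W = 6.0 / 5.7, 28 cells of
  side 4–6 from thermalised `8⁴` configurations) — min Re spec − edge → |m_c(β)| (dressing confirmed), E₀ − edge ≈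
  0.2–0.4 (window open), NO real eigenvalue below |m_c| anywhere; at 5.7 the first deep (late, `λ ≈ 2`) dislocation
  modes appear in `6⁴` cells.  Nothing bites (a′).

LANDED / LANDING (import these, not this work file): § 1 + § 4 = `Theorems/EarlyCrosserLaw/Negative/
CellPositivityDomain.lean` (p74201, accepted); § 2–§ 3 = `Theorems/EarlyCrosserLaw/Negative/LowerPinLoadBearing.lean`
(proposal pending), written over the sibling disprover's vocabulary for the hinge `CoerciveSea` — `PinClause` IS clause
(b) verbatim (`Theorems/CoerciveSea/Negative/PinWindow.lean`: pin window `(−8,0)`, `heavyJunkReg`, `a_k/Z_m → 0`;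
`SeilerBothSides.lean`: `det D_W > 0` for `|μ+4| > 4`; `CellDeterminants.lean`: Dirichlet cell determinants real and
positive off the hopping band).  § 3b below duplicates `SeilerBothSides` and stays here only to keep this file
self-contained.
-/

noncomputable section

open Matrix Complex Filter
open Literature.MathematicalPhysics.QuantumLattice Literature.MathematicalPhysics.QuantumFieldTheory
  Literature.Probability.LatticeModels
open Summit.QuantumFields.QCD.Theses.NestedDissectionSea

namespace Summit.QuantumFields.QCD.Cruxes.EarlyCrosserLaw.Disproof

open scoped Matrix.Norms.L2Operator ComplexConjugate

/-! ## § 1  Positivity domain for Dirichlet cells (numerical range of `D_W`) -/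

/-- Termwise polarisation bound: `Re(conj a · b) ≤ (‖a‖² + ‖b‖²)/2`. [folklore] -/
theorem re_conj_mul_le (a b : ℂ) : (conj a * b).re ≤ (‖a‖ ^ 2 + ‖b‖ ^ 2) / 2 := by
  rw [Complex.sq_norm, Complex.sq_norm, Complex.normSq_apply, Complex.normSq_apply]
  simp only [Complex.mul_re, Complex.conj_re, Complex.conj_im]
  nlinarith [sq_nonneg (a.re - b.re), sq_nonneg (a.im - b.im)]

section Torus

variable {L N : ℕ} [NeZero L] {G : Type*} [Group G] (ρ : G →* Matrix (Fin N) (Fin N) ℂ)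

/-- For a matrix of `ℓ²` operator norm `≤ 1`: `Re Σ_i conj(v i) (W v)_i ≤ Σ_i ‖v i‖²`. [folklore] -/
theorem re_sum_conj_mul_mulVec_le
    (W : Matrix (TorusSite 4 L × Fin N × Fin 4) (TorusSite 4 L × Fin N × Fin 4) ℂ)
    (hW : ‖W‖ ≤ 1) (v : TorusSite 4 L × Fin N × Fin 4 → ℂ) :
    (∑ i, conj (v i) * (W *ᵥ v) i).re ≤ ∑ i, ‖v i‖ ^ 2 := by
  have h1 : ∑ i, ‖(W *ᵥ v) i‖ ^ 2 ≤ ∑ i, ‖v i‖ ^ 2 := by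
    refine (sum_norm_sq_mulVec_le W v).trans ?_
    have h0 : 0 ≤ ∑ i, ‖v i‖ ^ 2 := Finset.sum_nonneg fun i _ => by positivity
    have : ‖W‖ ^ 2 ≤ 1 := by nlinarith [norm_nonneg W]
    nlinarith
  rw [Complex.re_sum]
  have h2 : ∑ i, (conj (v i) * (W *ᵥ v) i).re ≤ ∑ i, (‖v i‖ ^ 2 + ‖(W *ᵥ v) i‖ ^ 2) / 2 :=
    Finset.sum_le_sum fun i _ => re_conj_mul_le _ _
  have h3 : ∑ i, (‖v i‖ ^ 2 + ‖(W *ᵥ v) i‖ ^ 2) / 2 =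
      ((∑ i, ‖v i‖ ^ 2) + ∑ i, ‖(W *ᵥ v) i‖ ^ 2) / 2 := by
    rw [← Finset.sum_div, Finset.sum_add_distrib]
  linarith

/-- **Numerical range of the Wilson–Dirac operator** (`r = 1`, unitary colour representation, any
periodic four-torus, any gauge field, any real bare mass `m`): `m Σ_i‖v i‖² ≤ Re Σ_i conj(v i)(D_W v)_i`.
The hermitian part of the massless operator is the covariant Wilson Laplacian `½Σ_μ ∇_μ†∇_μ ≥ 0`;
here from `D_W = (m+4)·1 - Σ_μ W_μ` (`wilsonDirac_eq_sub_sum_wilsonHop`) and `‖W_μ‖ ≤ 1`.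
This is the exact layer E2/KineticEdge of the route at its crudest (edge `0` instead of
`Σ(1 - cos(π/s_i))`). [folklore] -/
theorem re_quadForm_wilsonDirac_ge (hρ : ∀ g, ρ g ∈ Matrix.unitaryGroup (Fin N) ℂ)
    (U : GaugeConfig 4 L G) (m : ℝ) (v : TorusSite 4 L × Fin N × Fin 4 → ℂ) :
    m * ∑ i, ‖v i‖ ^ 2 ≤ (∑ i, conj (v i) * (wilsonDirac ρ U m 1 *ᵥ v) i).re := by
  rw [wilsonDirac_eq_sub_sum_wilsonHop ρ hρ U m, Matrix.sub_mulVec, Matrix.smul_mulVec,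
    Matrix.one_mulVec, Matrix.sum_mulVec]
  have hdiag : (∑ i, conj (v i) * ((((m + 4 : ℝ) : ℂ) • v) i)).re = (m + 4) * ∑ i, ‖v i‖ ^ 2 := by
    rw [Complex.re_sum, Finset.mul_sum]
    refine Finset.sum_congr rfl fun i _ => ?_
    rw [Pi.smul_apply, smul_eq_mul, mul_left_comm, Complex.re_ofReal_mul, Complex.conj_mul',
      ← Complex.ofReal_pow, Complex.ofReal_re]
  have hsum : ∀ μ : Fin 4, (∑ i, conj (v i) * (wilsonHop ρ U μ *ᵥ v) i).re ≤ ∑ i, ‖v i‖ ^ 2 :=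
    fun μ => re_sum_conj_mul_mulVec_le (wilsonHop ρ U μ) (l2_opNorm_wilsonHop_le ρ hρ U μ) v
  have hexp : (∑ i, conj (v i) * ((((m + 4 : ℝ) : ℂ) • v) - ∑ μ, wilsonHop ρ U μ *ᵥ v) i) =
      (∑ i, conj (v i) * ((((m + 4 : ℝ) : ℂ) • v) i)) -
        ∑ μ, ∑ i, conj (v i) * (wilsonHop ρ U μ *ᵥ v) i := by
    rw [Finset.sum_comm, ← Finset.sum_sub_distrib]
    refine Finset.sum_congr rfl fun i _ => ?_
    rw [Pi.sub_apply, Finset.sum_apply, mul_sub, Finset.mul_sum]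
  rw [hexp, Complex.sub_re, hdiag, Complex.re_sum]
  have h4 : ∑ μ : Fin 4, (∑ i, conj (v i) * (wilsonHop ρ U μ *ᵥ v) i).re ≤
      ∑ _μ : Fin 4, ∑ i, ‖v i‖ ^ 2 := Finset.sum_le_sum fun μ _ => hsum μ
  have h4' : ∑ _μ : Fin 4, ∑ i, ‖v i‖ ^ 2 = 4 * ∑ i, ‖v i‖ ^ 2 := by simp
  linarith

/-- **Positivity domain for Dirichlet cells.** At bare mass `m > 0` no principal submatrix of the
Wilson–Dirac matrix (no Dirichlet cell, on ANY index set — boxes, children, separators) is singular,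
for every gauge field: a kernel vector, extended by zero, would have `Re⟨v, D_W v⟩ = 0 ≥ m‖v‖² > 0`.
Instance-polymorphic in the `Fintype`/`DecidableEq` structure of the subtype so that it applies to
the route's `wilsonCell` verbatim (which is `toSquareBlockProp … (wilsonBox x s)` by definition).
Consequence for the crux: the cover event of (a′) is EMPTY as soon as `m_f(k) > 0`. [folklore] -/
theorem det_toSquareBlockProp_wilsonDirac_ne_zero (hρ : ∀ g, ρ g ∈ Matrix.unitaryGroup (Fin N) ℂ)
    (U : GaugeConfig 4 L G) {m : ℝ} (hm : 0 < m) (p : TorusSite 4 L × Fin N × Fin 4 → Prop)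
    [Fintype {a // p a}] [DecidableEq {a // p a}] :
    (Matrix.toSquareBlockProp (wilsonDirac ρ U m 1) p).det ≠ 0 := by
  classical
  intro hdet
  obtain ⟨w, hw0, hw⟩ := Matrix.exists_mulVec_eq_zero_iff.mpr hdet
  set v : TorusSite 4 L × Fin N × Fin 4 → ℂ := fun i => if h : p i then w ⟨i, h⟩ else 0 with hv
  have hvp : ∀ i : {a // p a}, v i = w i := fun i => by simp [hv, i.2]
  have hvn : ∀ i, ¬ p i → v i = 0 := fun i hi => by simp [hv, hi]
  have hDv : ∀ i : {a // p a}, (wilsonDirac ρ U m 1 *ᵥ v) i =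
      (Matrix.toSquareBlockProp (wilsonDirac ρ U m 1) p *ᵥ w) i := by
    intro i
    simp only [Matrix.mulVec, dotProduct, Matrix.toSquareBlockProp_def, Matrix.of_apply]
    have hR : (∑ j : {a // p a}, wilsonDirac ρ U m 1 (i : TorusSite 4 L × Fin N × Fin 4) j * w j) =
        ∑ j ∈ Finset.univ.filter p,
          wilsonDirac ρ U m 1 (i : TorusSite 4 L × Fin N × Fin 4) j * v j := by
      rw [Finset.sum_subtype (Finset.univ.filter p) (p := p) (fun j => by simp)]
      exact Finset.sum_congr rfl fun j _ => by rw [hvp j]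
    rw [hR, Finset.sum_filter]
    refine Finset.sum_congr rfl fun j _ => ?_
    by_cases hj : p j
    · simp [hj]
    · simp [hj, hvn j hj]
  have hquad : (∑ i, conj (v i) * (wilsonDirac ρ U m 1 *ᵥ v) i) = 0 := by
    have : ∀ i, conj (v i) * (wilsonDirac ρ U m 1 *ᵥ v) i =
        if h : p i then conj (w ⟨i, h⟩) *
          (Matrix.toSquareBlockProp (wilsonDirac ρ U m 1) p *ᵥ w) ⟨i, h⟩ else 0 := by
      intro i
      by_cases hi : p i
      · rw [dif_pos hi, ← hDv ⟨i, hi⟩, hvp ⟨i, hi⟩]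
      · rw [dif_neg hi, hvn i hi, map_zero, zero_mul]
    simp_rw [this, hw, Pi.zero_apply, mul_zero, dite_eq_ite, ite_self, Finset.sum_const_zero]
  have hS : 0 < ∑ i, ‖v i‖ ^ 2 := by
    obtain ⟨i, hi⟩ : ∃ i, w i ≠ 0 := by
      by_contra h
      push Not at h
      exact hw0 (funext h)
    have hpos : 0 < ‖v i‖ ^ 2 := by rw [hvp i]; positivity
    have hle : ‖v i‖ ^ 2 ≤ ∑ j, ‖v j‖ ^ 2 :=
      Finset.single_le_sum (f := fun j => ‖v j‖ ^ 2) (fun j _ => by positivity)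
        (Finset.mem_univ (i : TorusSite 4 L × Fin N × Fin 4))
    exact lt_of_lt_of_le hpos hle
  have := re_quadForm_wilsonDirac_ge ρ hρ U m v
  rw [hquad, Complex.zero_re] at this
  nlinarith

end Torus

/-- **No Dirichlet cell of the SU(3) theory is singular at positive bare mass** (the route's
`wilsonCell`, any corner, any sides, any torus). [folklore] -/
theorem wilsonCell_det_ne_zero_of_pos {N : ℕ} [NeZero N] (U : GaugeConfig 4 N (Matrix.specialUnitaryGroup (Fin 3) ℂ)) {μ : ℝ}
    (hμ : 0 < μ) (x : TorusSite 4 N) (s : Fin 4 → ℕ) : (wilsonCell U μ x s).det ≠ 0 :=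
  det_toSquareBlockProp_wilsonDirac_ne_zero (fundamentalRep (Fin 3)) fundamentalRep_mem_unitaryGroup
    U hμ (wilsonBox x s)

/-! ## § 2  Load-bearing analysis: without the lower pin (b) the crux is trivially TRUE -/

section Clauses

open scoped Classical

/-- Clause (a′) of the crux (window dilution of early crossers), VERBATIM, as a predicate of the
data `(Nf, reg, b₀, ℓ, m, R)`. [folklore] -/
def DilutionClause (Nf : ℕ) (reg : QCDRegularisation Nf) (b₀ : ℕ) (ℓ : ℝ) (m : Fin Nf → ℝ)
    (R : ℝ) : Prop :=
  (∀ ε : ℝ, 0 < ε → ∀ᶠ k : ℕ in Filter.atTop, ∀ S : ℕ, R ≤ reg.a k * (2 * S + 1) → let N : ℕ := 2 * S + 1; let mq : Fin Nf → ℝ := fun f => reg.mcrit k + reg.a k * m f / reg.Zm k; let wt : GaugeConfig 4 N (Matrix.specialUnitaryGroup (Fin 3) ℂ) → ℝ := fun U => ∏ f, ‖fermionDet (wilsonDirac (fundamentalRep (Fin 3)) U (mq f) 1)‖; let P : (GaugeConfig 4 N (Matrix.specialUnitaryGroup (Fin 3) ℂ) → Prop) → ℝ := fun E => (∫ U, (if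 E U then (1 : ℝ) else 0) * wt U ∂(wilsonMeasure (d := 4) (L := N) (fundamentalRep (Fin 3)) (reg.β k))) / (∫ U, wt U ∂(wilsonMeasure (d := 4) (L := N) (fundamentalRep (Fin 3)) (reg.β k))); let J : ℕ := Nat.log 2 (⌊ℓ / reg.a k⌋₊ / b₀) + 1; ∃ δ : ℕ → ℝ, (∀ j, 0 ≤ δ j) ∧ ∑ j ∈ Finset.range J, δ j ≤ ε ∧ ∀ j < J, ∀ s : Fin 4 → ℕ, (∀ i, b₀ * 2 ^ j ≤ s i ∧ s i < b₀ * 2 ^ (j + 2) ∧ s i ≤ N ∧ (s i : ℝ) * reg.a k ≤ ℓ) → ∀ E : GaugeConfig 4 N (Matrix.specialUnitaryGroup (Fin 3) ℂ) → Prop, (∀ U, E U → ∃ f : Fin Nf, ∃ μ' : ℝ, mq f ≤ μ' ∧ ((wilsonCell U μ' 0 s).det = 0 ∨ ∃ c : Fin 4 → Bool, (wilsonCell U μ' (halfCorner s c) (halfSides s c)).det = 0)) → P E ≤ δ j)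

/-- Clause (b) of the crux (the LOWER parity pin), VERBATIM, as a predicate of `(Nf, reg, M₀, m, R)`.
[folklore] -/
def LowerPin (Nf : ℕ) (reg : QCDRegularisation Nf) (M₀ : ℝ) (m : Fin Nf → ℝ) (R : ℝ) : Prop :=
  (∀ M : ℝ, M₀ < M → ∀ᶠ k : ℕ in Filter.atTop, ∀ S : ℕ, R ≤ reg.a k * (2 * S + 1) → let N : ℕ := 2 * S + 1; let mq : Fin Nf → ℝ := fun f => reg.mcrit k + reg.a k * m f / reg.Zm k; let wt : GaugeConfig 4 N (Matrix.specialUnitaryGroup (Fin 3) ℂ) → ℝ := fun U => ∏ f, ‖fermionDet (wilsonDirac (fundamentalRep (Fin 3)) U (mq f) 1)‖; (1 / 4 : ℝ) ≤ (∫ U, (if (fermionDet (wilsonDirac (fundamentalRep (Fin 3)) U (reg.mcrit k - reg.a k * M / reg.Zm k) 1)).re < 0 then (1 : ℝ) else 0) * wt U ∂(wilsonMeasure (d := 4) (L := N) (fundamentalRep (Fin 3)) (reg.β k))) / (∫ U, wt U ∂(wilsonMeasure (d := 4) (L := N) (fundamentalRep (Fin 3)) (reg.β k))))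

/-- Clause (b″) of the crux (the UPPER parity pin), VERBATIM, as a predicate of `(Nf, reg, M₀, m, R)`.
[folklore] -/
def UpperPin (Nf : ℕ) (reg : QCDRegularisation Nf) (M₀ : ℝ) (m : Fin Nf → ℝ) (R : ℝ) : Prop :=
  (∀ M : ℝ, M₀ < M → ∀ᶠ k : ℕ in Filter.atTop, ∀ S : ℕ, R ≤ reg.a k * (2 * S + 1) → reg.a k * (2 * S + 1) ≤ 2 * R → let N : ℕ := 2 * S + 1; let mq : Fin Nf → ℝ := fun f => reg.mcrit k + reg.a k * m f / reg.Zm k; let wt : GaugeConfig 4 N (Matrix.specialUnitaryGroup (Fin 3) ℂ) → ℝ := fun U => ∏ f, ‖fermionDet (wilsonDirac (fundamentalRep (Fin 3)) U (mq f) 1)‖; (∫ U, (if (fermionDet (wilsonDirac (fundamentalRep (Fin 3)) U (reg.mcrit k + reg.a k * M / reg.Zm k) 1)).re < 0 then (1 : ℝ) else 0) * wt U ∂(wilsonMeasure (d := 4) (L := N) (fundamentalRep (Fin 3)) (reg.β k))) / (∫ U, wt U ∂(wilsonMeasure (d := 4) (L := N) (fundamentalRep (Fin 3)) (reg.β k)))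 ≤ (1 / 8 : ℝ))

/-- The crux re-assembled from the three named clauses (same prefix). [folklore] -/
def EarlyCrosserLawClauses : Prop :=
  ∀ Nf : ℕ, (Nf = 2 ∨ Nf = 3) → ∃ reg : QCDRegularisation Nf, reg.HasMassScaling ∧
    (reg.scheme 0 0 0).HasAsymptoticScaling ∧ ∃ M₀ : ℝ, 0 ≤ M₀ ∧ ∃ b₀ : ℕ, 2 ≤ b₀ ∧ ∃ ℓ : ℝ, 0 < ℓ ∧
    ∀ m : Fin Nf → ℝ, (∀ f, M₀ < m f) → ∃ R : ℝ, 0 < R ∧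
      DilutionClause Nf reg b₀ ℓ m R ∧ LowerPin Nf reg M₀ m R ∧ UpperPin Nf reg M₀ m R

/-- The clause decomposition IS the crux (definitional unfolding; certifies the verbatim copies).
[folklore] -/
theorem earlyCrosserLaw_iff_clauses : EarlyCrosserLaw ↔ EarlyCrosserLawClauses := Iff.rfl

/-- **The crux with the lower pin (b) deleted**: `∃ reg … ∀ m ∃ R, (a′) ∧ (b″)`. [folklore] -/
def EarlyCrosserLawWithoutLowerPin : Prop :=
  ∀ Nf : ℕ, (Nf = 2 ∨ Nf = 3) → ∃ reg : QCDRegularisation Nf, reg.HasMassScaling ∧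
    (reg.scheme 0 0 0).HasAsymptoticScaling ∧ ∃ M₀ : ℝ, 0 ≤ M₀ ∧ ∃ b₀ : ℕ, 2 ≤ b₀ ∧ ∃ ℓ : ℝ, 0 < ℓ ∧
    ∀ m : Fin Nf → ℝ, (∀ f, M₀ < m f) → ∃ R : ℝ, 0 < R ∧
      DilutionClause Nf reg b₀ ℓ m R ∧ UpperPin Nf reg M₀ m R

/-- Projection: the crux implies its lower-pin-free part. [folklore] -/
theorem withoutLowerPin_of_earlyCrosserLaw (h : EarlyCrosserLaw) : EarlyCrosserLawWithoutLowerPin := by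
  intro Nf hNf
  obtain ⟨reg, h1, h2, M₀, hM₀, b₀, hb₀, ℓ, hℓ, hm⟩ := h Nf hNf
  refine ⟨reg, h1, h2, M₀, hM₀, b₀, hb₀, ℓ, hℓ, fun m hmm => ?_⟩
  obtain ⟨R, hR, hA, -, hB2⟩ := hm m hmm
  exact ⟨R, hR, hA, hB2⟩

/-- The junk regularisation: the tree's `canonicalAF` (honest `a_k`, `Z_m`, asymptotically scaling
`β_k`) with the "critical line" parked at bare mass `+1`. [folklore] -/
def junkReg (Nf : ℕ) : QCDRegularisation Nf :=
  { QCDRegularisation.canonicalAF Nf with mcrit := fun _ => 1 }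

/-- The junk line is the constant `+1`. [folklore] -/
@[simp] theorem junkReg_mcrit (Nf k : ℕ) : (junkReg Nf).mcrit k = 1 := rfl

/-- `junkReg` has the honest leading-log mass scaling (it shares `a`, `Z_m` with `canonicalAF`).
[folklore] -/
theorem junkReg_hasMassScaling (Nf : ℕ) : (junkReg Nf).HasMassScaling :=
  QCDRegularisation.canonicalAF_hasMassScaling

/-- `junkReg` scales asymptotically (`β_k = afBeta N_f 1 a_k` exactly, `Λ = 1`). [folklore] -/
theorem junkReg_hasAsymptoticScaling (Nf : ℕ) : ((junkReg Nf).scheme 0 0 0).HasAsymptoticScaling := by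
  refine ⟨1, one_pos, ?_⟩
  simp [junkReg, QCDRegularisation.scheme, QCDRegularisation.canonicalAF, QCDScheme.zeroAF]

/-- The junk line sits at bare mass `+1`, so every bare quark mass of the junk scheme is positive.
[folklore] -/
theorem junkReg_mq_pos (Nf : ℕ) (k : ℕ) {x : ℝ} (hx : 0 < x) :
    0 < 1 + (junkReg Nf).a k * x / (junkReg Nf).Zm k := by
  have ha : 0 < (junkReg Nf).a k := (junkReg Nf).a_pos k
  have hZ : 0 < (junkReg Nf).Zm k := (junkReg Nf).Zm_pos k
  positivity

/-- Same, in the un-reduced form `m_crit(k) + a_k x/Z_m(k)`. [folklore] -/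
theorem junkReg_mq_pos' (Nf : ℕ) (k : ℕ) {x : ℝ} (hx : 0 < x) :
    0 < (junkReg Nf).mcrit k + (junkReg Nf).a k * x / (junkReg Nf).Zm k :=
  junkReg_mq_pos Nf k hx

/-- **LOAD-BEARING: the lower pin (b) is the only content-bearing clause.** With (b) deleted the
crux is a THEOREM, by the junk witness `junkReg` (`m_crit ≡ +1`), `M₀ = 0`, `b₀ = 2`, `ℓ = R = 1`,
`δ ≡ 0`: every bare mass is `> 0`, so (a′) the cover event is EMPTY (no Dirichlet cell is singular
at positive bare mass, § 1) and (b″) `Re det D_W > 0` (Seiler's positivity domain,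
`fermionDet_wilsonDirac_re_pos`), both numerators vanish identically and `0/x = 0`.  No measure
theory, no KineticEdge hypothesis (this discharges the two hypotheses of refuter rattack-13978's
`PinLoadBearing.lean`).  Reading for provers: every use of (a′)/(b″) in a proof of
NegativeCellsDilute-type consequences is vacuous unless it is coupled to (b); reading for refuters:
any disproof must live where (b) holds, i.e. near the honest critical line. [folklore] -/
theorem trivial_without_lowerPin : EarlyCrosserLawWithoutLowerPin := by
  intro Nf _hNf
  refine ⟨junkReg Nf, junkReg_hasMassScaling Nf, junkReg_hasAsymptoticScaling Nf, 0, le_rfl, 2,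
    le_rfl, 1, one_pos, fun m hm => ⟨1, one_pos, ?_, ?_⟩⟩
  · -- (a′): the cover event is empty, δ ≡ 0
    intro ε hε
    refine Filter.Eventually.of_forall fun k S _hS => ?_
    dsimp only
    refine ⟨fun _ => 0, fun _ => le_rfl, by simp [hε.le], ?_⟩
    intro j _hj s _hs E hE
    have hE0 : ∀ U, ¬ E U := by
      intro U hU
      obtain ⟨f, μ', hμ', hsing⟩ := hE U hU
      have hμ'pos : 0 < μ' := lt_of_lt_of_le (junkReg_mq_pos' Nf k (hm f)) hμ'
      rcases hsing with h | ⟨c, h⟩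
      · exact wilsonCell_det_ne_zero_of_pos U hμ'pos _ _ h
      · exact wilsonCell_det_ne_zero_of_pos U hμ'pos _ _ h
    simp [hE0]
  · -- (b″): positive bare mass ⇒ Re det > 0 ⇒ the sign indicator vanishes
    intro M hM
    refine Filter.Eventually.of_forall fun k S _hS _hS2 => ?_
    dsimp only
    have hpos : ∀ U : GaugeConfig 4 (2 * S + 1) (Matrix.specialUnitaryGroup (Fin 3) ℂ),
        ¬ (fermionDet (wilsonDirac (fundamentalRep (Fin 3)) U
          (1 + (junkReg Nf).a k * M / (junkReg Nf).Zm k) 1)).re < 0 :=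
      fun U => not_lt.mpr (fermionDet_wilsonDirac_re_pos (fundamentalRep (Fin 3))
        fundamentalRep_mem_unitaryGroup U (junkReg_mq_pos Nf k hM)).le
    simp [hpos]

/-! ## § 3  What the lower pin forces (measure-free consequences of (b)) -/

/-- **(b) forces the line below `+a_k M/Z_m` eventually**: if `m_crit(k) - a_k M/Z_m(k) > 0` the
pinned determinant is positive for every `U` (Seiler), the indicator vanishes and the pinned
probability is `0 < 1/4`.  So every witness of the crux has `m_crit(k) ≤ a_k M/Z_m(k)` eventually,
for every `M > M₀`: the valence thresholds `-m_f(k)` of (a′) are `≥ -a_k(M₀ + o(1))/Z_m - a_k m_f/Z_m`,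
i.e. (a′) cannot be emptied by translating the line upward (refuter g47-0's flag, now a lemma).
[folklore] -/
theorem lowerPin_forces_mcrit_le {Nf : ℕ} {reg : QCDRegularisation Nf} {M₀ : ℝ} {m : Fin Nf → ℝ}
    {R : ℝ} (h : LowerPin Nf reg M₀ m R) {M : ℝ} (hM : M₀ < M) :
    ∀ᶠ k : ℕ in Filter.atTop, reg.mcrit k ≤ reg.a k * M / reg.Zm k := by
  have hev := h M hM
  have hbig : ∀ᶠ k : ℕ in Filter.atTop, ∃ S : ℕ, R ≤ reg.a k * (2 * S + 1) := by
    refine Filter.Eventually.of_forall fun k => ?_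
    obtain ⟨S, hS⟩ := exists_nat_ge (R / reg.a k)
    refine ⟨S, ?_⟩
    have ha : 0 < reg.a k := reg.a_pos k
    have : R ≤ reg.a k * S := by rwa [div_le_iff₀' ha] at hS
    nlinarith
  filter_upwards [hev, hbig] with k hk ⟨S, hS⟩
  by_contra hlt
  push Not at hlt
  have hmass : 0 < reg.mcrit k - reg.a k * M / reg.Zm k := by linarith
  have hk' := hk S hS
  dsimp only at hk'
  have hpos : ∀ U : GaugeConfig 4 (2 * S + 1) (Matrix.specialUnitaryGroup (Fin 3) ℂ),
      ¬ (fermionDet (wilsonDirac (fundamentalRep (Fin 3)) U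
        (reg.mcrit k - reg.a k * M / reg.Zm k) 1)).re < 0 :=
    fun U => not_lt.mpr (fermionDet_wilsonDirac_re_pos (fundamentalRep (Fin 3))
      fundamentalRep_mem_unitaryGroup U hmass).le
  simp [hpos] at hk'
  linarith

end Clauses

/-! ## § 3b  … and above the bottom of the Wilson band: `det D_W > 0` for bare mass `< -8` -/

section BelowBand

variable {L N : ℕ} [NeZero L] {G : Type*} [Group G] (ρ : G →* Matrix (Fin N) (Fin N) ℂ)

section L2
open scoped Matrix.Norms.L2Operator

/-- For a real `c` with `4|c| < 1` the matrix `1 - c•Σ_μ W_μ` is a unit (Neumann series). [folklore] -/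
theorem isUnit_one_sub_smul_sum_wilsonHop (hρ : ∀ g, ρ g ∈ Matrix.unitaryGroup (Fin N) ℂ)
    (U : GaugeConfig 4 L G) {c : ℝ} (hc : 4 * |c| < 1) :
    IsUnit (1 - ((c : ℝ) : ℂ) • ∑ μ, wilsonHop ρ U μ) := by
  have hK := l2_opNorm_sum_wilsonHop_le ρ hρ U
  have hnorm : ‖((c : ℝ) : ℂ) • ∑ μ, wilsonHop ρ U μ‖ < 1 := by
    rw [norm_smul, Complex.norm_real, Real.norm_eq_abs]
    calc |c| * ‖∑ μ, wilsonHop ρ U μ‖ ≤ |c| * 4 := by gcongr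
      _ < 1 := by linarith
  exact ⟨Units.oneSub _ hnorm, rfl⟩

end L2

omit [NeZero L] in
/-- For `c ≠ 0`, `1 - c•ΣW = c • D_W(1/c - 4)`. [folklore] -/
theorem one_sub_smul_eq_smul_wilsonDirac (hρ : ∀ g, ρ g ∈ Matrix.unitaryGroup (Fin N) ℂ)
    (U : GaugeConfig 4 L G) {c : ℝ} (hc : c ≠ 0) :
    (1 - ((c : ℝ) : ℂ) • ∑ μ, wilsonHop ρ U μ) = ((c : ℝ) : ℂ) • wilsonDirac ρ U (1 / c - 4) 1 := by
  rw [wilsonDirac_eq_sub_sum_wilsonHop ρ hρ, smul_sub, smul_smul, ← Complex.ofReal_mul,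
    show c * (1 / c - 4 + 4) = 1 by field_simp; ring, Complex.ofReal_one, one_smul]

/-- `det (1 - c•ΣW)` is real. [folklore] -/
theorem det_one_sub_smul_im (hρ : ∀ g, ρ g ∈ Matrix.unitaryGroup (Fin N) ℂ)
    (U : GaugeConfig 4 L G) (c : ℝ) :
    ((1 - ((c : ℝ) : ℂ) • ∑ μ, wilsonHop ρ U μ).det).im = 0 := by
  rcases eq_or_ne c 0 with h | hc
  · subst h; simp
  · rw [one_sub_smul_eq_smul_wilsonDirac ρ hρ U hc, det_smul]
    have hreal : ((wilsonDirac ρ U (1 / c - 4) 1).det).im = 0 :=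
      fermionDet_wilsonDirac_im_holds (L := L) ρ hρ U (1 / c - 4) 1
    set d := (wilsonDirac ρ U (1 / c - 4) 1).det with hd
    have hd' : d = ((d.re : ℝ) : ℂ) := Complex.ext (by simp) (by rw [Complex.ofReal_im]; exact hreal)
    rw [hd', ← Complex.ofReal_pow, ← Complex.ofReal_mul, Complex.ofReal_im]

/-- `t ↦ det (1 - (t c)•ΣW)` is continuous. [folklore] -/
theorem continuous_det_one_sub_smul (U : GaugeConfig 4 L G) (c : ℝ) :
    Continuous fun t : ℝ => ((1 - (((t * c : ℝ)) : ℂ) • ∑ μ, wilsonHop ρ U μ)).det := by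
  have h : Continuous fun t : ℝ => (1 - (((t * c : ℝ)) : ℂ) • ∑ μ, wilsonHop ρ U μ) := by
    refine continuous_const.sub ?_
    have h1 : Continuous fun t : ℝ => (((t * c : ℝ)) : ℂ) :=
      Complex.continuous_ofReal.comp (continuous_id.mul continuous_const)
    exact h1.smul continuous_const
  exact h.matrix_det

/-- `Re det (1 - c•ΣW) > 0` whenever `4|c| < 1` (IVT along `t ↦ 1 - (tc)•ΣW`). [folklore] -/
theorem re_det_one_sub_smul_pos (hρ : ∀ g, ρ g ∈ Matrix.unitaryGroup (Fin N) ℂ)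
    (U : GaugeConfig 4 L G) {c : ℝ} (hc : 4 * |c| < 1) :
    0 < ((1 - ((c : ℝ) : ℂ) • ∑ μ, wilsonHop ρ U μ).det).re := by
  set g : ℝ → ℝ := fun t => (((1 - (((t * c : ℝ)) : ℂ) • ∑ μ, wilsonHop ρ U μ)).det).re with hgdef
  have hg : Continuous g := Complex.continuous_re.comp (continuous_det_one_sub_smul ρ U c)
  have hg0 : g 0 = 1 := by simp [hgdef]
  have hne : ∀ t ∈ Set.Icc (0 : ℝ) 1, g t ≠ 0 := by
    intro t ht h0
    have htc : 4 * |t * c| < 1 := by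
      rw [abs_mul, abs_of_nonneg ht.1]
      calc 4 * (t * |c|) = t * (4 * |c|) := by ring
        _ ≤ 1 * (4 * |c|) := by gcongr; exact ht.2
        _ < 1 := by linarith
    have hunit := isUnit_one_sub_smul_sum_wilsonHop ρ hρ U htc
    apply ((Matrix.isUnit_iff_isUnit_det _).mp hunit).ne_zero
    exact Complex.ext (by simpa [hgdef] using h0) (by simpa using det_one_sub_smul_im ρ hρ U (t * c))
  have hg1 : 0 < g 1 := by
    refine lt_of_not_ge fun hle => ?_
    have hmem : (0 : ℝ) ∈ Set.Icc (g 1) (g 0) := ⟨hle, by rw [hg0]; norm_num⟩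
    obtain ⟨t, ht, ht0⟩ := intermediate_value_Icc' zero_le_one hg.continuousOn hmem
    exact hne t ht ht0
  simpa [hgdef] using hg1

/-- The index set of one Wilson flavour has EVEN cardinality (`4 ∣ #`). [folklore] -/
theorem even_card_idx : Even (Fintype.card (TorusSite 4 L × Fin N × Fin 4)) := by
  rw [Fintype.card_prod, Fintype.card_prod, Fintype.card_fin, Fintype.card_fin]
  exact ⟨Fintype.card (TorusSite 4 L) * (N * 2), by ring⟩

/-- **The mirror of Seiler's positivity domain: `det D_W(U, μ, 1) > 0` for bare mass `μ < -8`**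
(hopping parameter `κ = 1/(2μ+8) ∈ (-1/8, 0)`): `D_W = (μ+4)(1 - (μ+4)⁻¹ΣW)` with
`4|μ+4|⁻¹ < 1`, the second factor has positive real determinant and `(μ+4)^n > 0` because the
index set is even. Consequence for the crux: the lower pin (b) also forces
`m_crit(k) - a_k M/Z_m(k) ≥ -8` eventually (the pinned probability vanishes below the Wilson band). [folklore] -/
theorem fermionDet_wilsonDirac_re_pos_of_lt_neg_eight (hρ : ∀ g, ρ g ∈ Matrix.unitaryGroup (Fin N) ℂ)
    (U : GaugeConfig 4 L G) {μ : ℝ} (hμ : μ < -8) :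
    0 < (fermionDet (wilsonDirac ρ U μ 1)).re := by
  have hμ4 : μ + 4 < 0 := by linarith
  have hμ4ne : μ + 4 ≠ 0 := hμ4.ne
  set c : ℝ := 1 / (μ + 4) with hcdef
  have hc : 4 * |c| < 1 := by
    rw [hcdef, abs_div, abs_one, abs_of_neg hμ4]
    rw [show 4 * (1 / -(μ + 4)) = 4 / (-(μ + 4)) by ring, div_lt_one (by linarith)]
    linarith
  have hD : wilsonDirac ρ U μ 1 = ((μ + 4 : ℝ) : ℂ) • (1 - ((c : ℝ) : ℂ) • ∑ ν, wilsonHop ρ U ν) := by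
    rw [smul_sub, smul_smul, ← Complex.ofReal_mul, hcdef,
      show (μ + 4) * (1 / (μ + 4)) = 1 by field_simp, Complex.ofReal_one, one_smul,
      wilsonDirac_eq_sub_sum_wilsonHop ρ hρ]
  have hpos := re_det_one_sub_smul_pos ρ hρ U hc
  have him := det_one_sub_smul_im ρ hρ U c
  set d := ((1 - ((c : ℝ) : ℂ) • ∑ ν, wilsonHop ρ U ν)).det with hd
  have hd' : d = ((d.re : ℝ) : ℂ) := Complex.ext (by simp) (by simpa using him)
  have hdet : fermionDet (wilsonDirac ρ U μ 1) =
      (((μ + 4) ^ Fintype.card (TorusSite 4 L × Fin N × Fin 4) * d.re : ℝ) : ℂ) := by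
    rw [fermionDet, hD, det_smul, ← hd, hd', Complex.ofReal_re, ← Complex.ofReal_pow, ← Complex.ofReal_mul]
  rw [hdet, Complex.ofReal_re]
  exact mul_pos (even_card_idx.pow_pos hμ4ne) hpos

end BelowBand

/-- **(b) also forces the pinned mass to stay above `-8`**: if `m_crit(k) - a_k M/Z_m(k) < -8` the
pinned determinant is positive for every `U` (`fermionDet_wilsonDirac_re_pos_of_lt_neg_eight`), so
the pinned probability is `0 < 1/4`.  With `lowerPin_forces_mcrit_le`: every witness has
`m_crit(k) - a_k M/Z_m(k) ∈ [-8, 0]` eventually, for every `M > M₀` — the pin confines the line to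
the Wilson band. [folklore] -/
theorem lowerPin_forces_pinnedMass_ge {Nf : ℕ} {reg : QCDRegularisation Nf} {M₀ : ℝ}
    {m : Fin Nf → ℝ} {R : ℝ} (h : LowerPin Nf reg M₀ m R) {M : ℝ} (hM : M₀ < M) :
    ∀ᶠ k : ℕ in Filter.atTop, -8 ≤ reg.mcrit k - reg.a k * M / reg.Zm k := by
  have hev := h M hM
  have hbig : ∀ᶠ k : ℕ in Filter.atTop, ∃ S : ℕ, R ≤ reg.a k * (2 * S + 1) := by
    refine Filter.Eventually.of_forall fun k => ?_
    obtain ⟨S, hS⟩ := exists_nat_ge (R / reg.a k)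
    refine ⟨S, ?_⟩
    have ha : 0 < reg.a k := reg.a_pos k
    have : R ≤ reg.a k * S := by rwa [div_le_iff₀' ha] at hS
    nlinarith
  filter_upwards [hev, hbig] with k hk ⟨S, hS⟩
  by_contra hlt
  push Not at hlt
  have hk' := hk S hS
  dsimp only at hk'
  have hpos : ∀ U : GaugeConfig 4 (2 * S + 1) (Matrix.specialUnitaryGroup (Fin 3) ℂ),
      ¬ (fermionDet (wilsonDirac (fundamentalRep (Fin 3)) U
        (reg.mcrit k - reg.a k * M / reg.Zm k) 1)).re < 0 :=
    fun U => not_lt.mpr (fermionDet_wilsonDirac_re_pos_of_lt_neg_eight (fundamentalRep (Fin 3))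
      fundamentalRep_mem_unitaryGroup U hlt).le
  simp [hpos] at hk'
  linarith

/-! ## § 4  Tightness: the only gauge-field-independent crossing is `μ' = -4` (one-site cells) -/

section OneSite

variable {N : ℕ} [NeZero N]


/-- In a box with all sides `2` the site of every index is the corner shifted by `(1,1,1,1)`. -/
theorem site_eq_of_wilsonBox_two (hN : 2 ≤ N) (x : TorusSite 4 N)
    (p : TorusSite 4 N × Fin 3 × Fin 4) (hp : wilsonBox x (fun _ => 2) p) :
    p.1 = fun i => x i + 1 := by
  funext i
  obtain ⟨h0, h2⟩ := hp i
  have h2' : (p.1 i - x i).val < 2 := h2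
  have h1 : (p.1 i - x i).val = 1 := by omega
  have hval : (p.1 i - x i).val = (1 : ZMod N).val := by
    rw [h1, ZMod.val_one'' (by omega)]
  have := ZMod.val_injective N hval
  rw [sub_eq_iff_eq_add'] at this
  rw [this]

/-- No Wilson hop stays inside a one-site box (`N ≥ 2`). -/
theorem not_shift_of_wilsonBox_two (hN : 2 ≤ N) (x : TorusSite 4 N)
    (p q : TorusSite 4 N × Fin 3 × Fin 4) (hp : wilsonBox x (fun _ => 2) p)
    (hq : wilsonBox x (fun _ => 2) q) (μ : Fin 4) : q.1 ≠ Literature.MathematicalPhysics.QuantumFieldTheory.Site.shift p.1 μ := by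
  intro h
  have hp' := site_eq_of_wilsonBox_two hN x p hp
  have hq' := site_eq_of_wilsonBox_two hN x q hq
  rw [Literature.MathematicalPhysics.QuantumFieldTheory.Site.shift, hp', hq'] at h
  have h' := congr_fun h μ
  simp only [Pi.add_apply, Pi.single_eq_same] at h'
  have h1 : (1 : ZMod N) = 0 := by
    have := h'
    -- x μ + 1 = x μ + 1 + 1
    have : x μ + 1 + 1 = x μ + 1 + 0 := by rw [add_zero]; exact this.symm
    exact add_left_cancel this
  rw [ZMod.one_eq_zero_iff] at h1
  omega

/-- **The one-site Dirichlet cell is the scalar `μ + 4`**: for sides `(2,2,2,2)` the cell matrix of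
ANY gauge field is `(μ+4)·1` (no hop stays inside). -/
theorem wilsonCell_two_eq_smul_one (hN : 2 ≤ N) (U : GaugeConfig 4 N (Matrix.specialUnitaryGroup (Fin 3) ℂ)) (μ : ℝ) (x : TorusSite 4 N) :
    wilsonCell U μ x (fun _ => 2) = ((μ + 4 : ℝ) : ℂ) • (1 : Matrix _ _ ℂ) := by
  ext p q
  have hp := p.2
  have hq := q.2
  have hnf : ∀ ν : Fin 4, ¬ ((q : TorusSite 4 N × Fin 3 × Fin 4).1 = Literature.MathematicalPhysics.QuantumFieldTheory.Site.shift (p : TorusSite 4 N × Fin 3 × Fin 4).1 ν) :=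
    fun ν => not_shift_of_wilsonBox_two hN x p q hp hq ν
  have hnb : ∀ ν : Fin 4, ¬ ((p : TorusSite 4 N × Fin 3 × Fin 4).1 = Literature.MathematicalPhysics.QuantumFieldTheory.Site.shift (q : TorusSite 4 N × Fin 3 × Fin 4).1 ν) :=
    fun ν => not_shift_of_wilsonBox_two hN x q p hq hp ν
  simp only [wilsonCell, Matrix.toSquareBlockProp_def, Matrix.of_apply, wilsonDirac, hnf, hnb,
    if_false, add_zero, Finset.sum_const_zero, mul_zero, sub_zero, Matrix.smul_apply,
    Matrix.one_apply, smul_eq_mul, mul_ite, mul_one, Subtype.ext_iff]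

/-- Its determinant is `(μ+4)^{#cell}`. -/
theorem det_wilsonCell_two (hN : 2 ≤ N) (U : GaugeConfig 4 N (Matrix.specialUnitaryGroup (Fin 3) ℂ)) (μ : ℝ) (x : TorusSite 4 N) :
    (wilsonCell U μ x (fun _ => 2)).det =
      ((μ + 4 : ℝ) : ℂ) ^ Fintype.card {p // wilsonBox x (fun _ => (2 : ℕ)) p} := by
  rw [wilsonCell_two_eq_smul_one hN U μ x, det_smul, det_one, mul_one]

/-- The one-site box is non-empty (`N ≥ 2`). -/
theorem card_wilsonBox_two_pos (hN : 2 ≤ N) (x : TorusSite 4 N) :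
    0 < Fintype.card {p // wilsonBox x (fun _ => (2 : ℕ)) p} := by
  refine Fintype.card_pos_iff.mpr ⟨⟨((fun i => x i + 1), 0, 0), fun i => ?_⟩⟩
  simp only [add_sub_cancel_left, ZMod.val_one'' (show N ≠ 1 by omega)]
  omega

/-- **The only gauge-field-independent crossing: `μ' = −4`.**  For every SU(3) field on every torus
of side `N ≥ 2`, the one-site Dirichlet cell (sides `(2,2,2,2)`, the `j = 0` window box when
`b₀ = 2`, and a child of the window boxes of sides `≤ 5`) is singular EXACTLY at bare mass `-4`.
Tightness reading: the restriction `μ' ≥ m_f(k)` in the cover event of (a′) is what keeps (a′) from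
being refuted by a certain event (through `P(univ) = 1` or the den = 0 dichotomy) — it would bite
only for `m_f(k) ≤ -4`, excluded by the lower pin near the honest line. -/
theorem wilsonCell_two_det_eq_zero_iff (hN : 2 ≤ N) (U : GaugeConfig 4 N (Matrix.specialUnitaryGroup (Fin 3) ℂ)) (μ : ℝ)
    (x : TorusSite 4 N) : (wilsonCell U μ x (fun _ => 2)).det = 0 ↔ μ = -4 := by
  rw [det_wilsonCell_two hN, pow_eq_zero_iff (card_wilsonBox_two_pos hN x).ne', Complex.ofReal_eq_zero]
  constructor <;> intro h <;> linarith

end OneSite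

/-! ### § 4b  Remark (paper proof + numerics, not formalised): `μ' = −4` is singular on EVERY even-sided box

At `μ' = −4` the diagonal of the Dirichlet cell matrix vanishes and `wilsonCell U (−4) x s = −H_box`, the
compression of the hopping matrix `Σ_μ W_μ`.  Inside a non-wrapping box (`s_i ≤ N`) hops join sites whose
offset-parities `(Σ_i offset_i) mod 2` differ, so with `E = diag((−1)^{Σ offset})` one has `E H_box E = −H_box`:
`H_box` maps the `E = +1` functions (dimension `12 n_even`) into the `E = −1` functions (dimension `12 n_odd`)
and back.  If `n_even ≠ n_odd` the restriction to the larger side has a kernel, so `det wilsonCell U (−4) x s = 0`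
FOR EVERY GAUGE FIELD, with nullity `≥ 12 |n_even − n_odd|`.  For a box with interior extents `s_i − 1` one has
`n_even − n_odd = ∏_i Σ_{t=1}^{s_i−1} (−1)^t`, which is `±1` iff every `s_i` is EVEN (all interior extents odd)
and `0` otherwise.  Hence: the gauge-field-independent crossing `μ' = −4` of § 4 (the one-site cell, `s ≡ 2`)
occurs on every even-sided box `s ∈ (2ℕ)^4` — and, by the numerics of § 6, nowhere else robustly (odd-sided free
cells have no real eigenvalue at all).  This is exactly the pattern seen in E1/E2: 12 real eigenvalues at
`4.0000` in every `4⁴`/`6⁴` cell (interiors `3⁴`, `5⁴`) for free, noisy, Haar AND thermalised β_W = 6.0 links,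
none in `3⁴`/`5⁴`/`7⁴` cells.  Consequences: (i) still no bite on (a′) (needs `m_f(k) ≤ −4`); (ii) at `μ = −4`
the route's `sepFactor` is junk (`x/0`) on even-sided boxes — irrelevant at honest masses, but any telescoping
identity stated for ALL `μ` must carry the invertibility hypothesis (as `SchurCellStep` does).
-/


/-! ## § 5  Why it resists — the disprover's accounting (prose for the provers; no Lean content)

Write `B_U` for the massless `r = 1` Wilson operator, `W_U = ½(B_U + B_U†) = ½Σ_μ∇_μ†∇_μ ≥ 0`
(covariant Wilson Laplacian), `λ` for a REAL eigenvalue of a Dirichlet cell of `B_U`; the cell is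
singular at bare mass `μ' = -λ`, and it is an EARLY CROSSER for flavour `f` iff
`λ ≤ -m_f(k) = |m_crit(k)| - a_k m_f/Z_m(k) =: |m_c| - h`.

1. KINEMATICS (proved pieces: § 1 here, route items KineticEdge/ChiralityPairing).  By zero-extension
   the cell quadratic form is the torus one, so `λ = ⟨w, W_U w⟩/‖w‖² ≥ max(E₀(W_U), Σ_i(1 - cos(π/s_i)))`.
   Early crossing therefore needs kinetic energy in the window `[E₀(W_U), |m_c| - h]`, which is
   NON-EMPTY for typical rough `U` (`E₀(W_U) ≈ 4(1 - u₀) ≈ 0.5 < |m_c| = 0.82` at β_W = 6.0; one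
   loop `≈ 0.31 g₀²` vs `0.434 g₀²`, i.e. 36.7 vs 51.4 in units `g₀²C_F/16π²` — sibling crux
   stmt-13900 FINDINGS-ideator1 §1): the anti-hermitian part pushes the extended spectrum of `B_U`
   up from `E₀(W_U)` to `|m_c|` (second-order shift `Σ_m |A_mn|²/(λ_m - λ_n) > 0` for the bottom
   state).  So "no early crosser" is NOT a numerical-range fact; it is a statement about the
   NON-NORMAL outliers of `B_U` below its typical spectral edge — the honest open content.
2. FIXED-SHAPE DISLOCATIONS DROP OUT.  A carrier of bounded lattice size `r` has `λ ≥ 2π²/r²`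
   (cubic edge), while `|m_c(β_k)| ≈ 0.434 g₀² → 0`: eventually every fixed shape crosses LATE.
   Only carriers of lattice size `≥ s_free(β) = π(2/|m_c|)^{1/2} ≈ 2.75 β_W^{1/2} → ∞` matter
   (these are the "exceptional configurations" of β_W = 5.7–6.0, where `|m_c| ≈ 1`; they are a
   finite-β phenomenon by this mechanism alone).
3. SMOOTH CARRIERS CROSS AT OR BELOW THE LINE.  For a smooth field of scale `ρ ≫ 1` a real
   eigenvalue near the bottom needs an (approximate) zero mode of the continuum Dirac operator
   (otherwise `Im λ ≍ 1/ρ ≫` Wilson mixing `≍ 1/ρ²`): topology (`k = 1` zero mode, action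
   `8π²/g²`, lattice value `≥ 0.95` of it for `ρ ≥ 2`) or an accidental index-0 PAIR (`k = 2`);
   in both cases `λ = |m_c| + c/ρ²` with `c = ½‖D ψ₀‖²ρ² > 0` (Weitzenböck) AFTER the universal UV
   dressing — i.e. LATE by `c/ρ²`, early only through an upward fluctuation `≥ c/ρ² + h`.
4. COUNTING (dilute gas; what the exponents must satisfy).  A carrier species of action
   `κ·8π²/g²` (κ = 1: instanton) with `k` would-be zero modes and lattice size `x` has density per
   PHYSICAL volume `≍ a^{bκ-4} Λ^{bκ} x^{bκ-5} dx × (determinant factor) × P(early | species, x)`,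
   `b = 11 - 2N_f/3`.  (i) The determinant factor of the crux's own weight `∏_f|det D_W(m_f)|` is
   `(m_eff x a)^{kN_f}` with `m_eff = m + c/(x²a)` (the Wilson term gives the would-be zero mode the
   mass `c/x²` in lattice units): it is `≍ (mρ_p)^{kN_f}` only at `x ≍ ρ_* ≍ a^{-1/2}` and merely
   `(c/x)^{kN_f} = O(polylog)` at the small early-capable end `x ≍ s_free` — so, CORRECTING an
   earlier draft of this note, the sea determinant does NOT by itself close any loophole at the
   small-size end.  (ii) Every smooth carrier crosses LATE by `c/x²` (item 3), so being early costs
   an upward fluctuation of `≥ c/x²`, i.e. `≥ c/(c₁g)` standard deviations of the first-order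
   response `σ ≍ c₁ g(xa)/x²`: `P(early | x) ≍ exp(-(c/c₁)²/2g²(xa)) = (x a Λ)^{b'}`,
   `b' = b₀(c/c₁)²` (Mohler–Schaefer's a^{6.8} at a = 0.086 → 0.05 fm reads b' ≈ 2–9 for
   instantons, c₁ ≈ 0.06–0.12).  (iii) Hence species (κ, k, b') contributes `a^{(bκ + b' + kN_f - 4)/2}` from
   `x ≍ ρ_*` and `a^{bκ + b' - 4}` (× polylog) from `x ≍ s_free`: the window sum vanishes iff
   `bκ + b' > 4` (the determinant helps only at the large-size end).  Instantons: `b - 4 = 5, 17/3 > 0` already at `b' = 0` ✓ (the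
   route's (L5): no constant needs to be sharp).  The ONLY way to fail: a species with
   `κ < (4 - b')/b`, i.e. Yang–Mills action below ≈ 22–44 % of an instanton (N_f = 3; 25–41 %
   N_f = 2), carrying an exactly real Wilson mode near the bottom — by item 3 a smooth SU(3)
   connection on ℝ⁴ with `Q = 0` and an ACCIDENTAL zero-mode pair of the Dirac operator
   (`k = 2`).  A Lichnerowicz–Kato–Sobolev vanishing argument gives a universal ZERO-MODE ACTION FLOOR
   `κ ≥ κ₀ > 0`: on the unit S⁴ (conformal to ℝ⁴; `∫‖𝔉‖²` and `∫|F|²` are conformally invariant)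
   `D̸_A² = ∇*∇ + 3 + 𝔉`, `𝔉 = Σ_{μ<ν} c(e^μ)c(e^ν)F_{μν}`, so a zero mode has
   `‖∇ψ‖² + 3‖ψ‖² = -⟨ψ,𝔉ψ⟩ ≤ ‖𝔉‖_{L²}‖ψ‖²_{L⁴} ≤ 0.0975 ‖𝔉‖_{L²}(‖∇ψ‖² + 2‖ψ‖²)` (sharp
   Aubin–Beckner constant `1/(2 vol(S⁴)^{1/2}) = 0.0975`, Kato), whence `∫‖𝔉‖²_op ≥ 105`;
   pointwise `‖𝔉|_{S^±}‖²_op = 4‖Σ_a σ_a ⊗ H^±_a‖² ≤ 12 Σ_a‖H^±_a‖² ≤ 6|F|²` in general and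
   `= 2|F^±|²` for commuting curvature components, so with `∫|F|² = 8π²κ`:
   `κ₀ ≥ 105/(6·8π²) = 0.22` in general, `≥ 0.67` for abelian-like curvature; embedded U(1)
   fluxes `diag(q)·f` need `κ ≥ 1.0–1.3` by the same bound.  Against the threshold
   `4/b = 0.44/0.41` (or `(4-b')/b ≈ 0.2` with the fluctuation bonus b' ≈ 2) this is INCONCLUSIVE:
   the cheap rigorous floor 0.22 sits below 4/b, no Q = 0 zero-mode carrier cheaper than an
   instanton is known (conjecture: κ₀ ≥ 1 — spin–isospin locking makes the instanton the optimal
   Clifford coupling per unit action), and nothing here is sharp (Kato, Hölder, Sobolev and the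
   Clifford norm are all lossy on zero modes).
   (The sibling ideator of stmt-13900, FINDINGS-ideator1 §2, reached the same floor question.)
5. WHAT IS LEFT = THE SHARP TARGET (for refuters AND provers).  Decide
      `κ₀(SU(3)) := inf { S_YM(A)/(8π²/g²) : A smooth on ℝ⁴, finite action, Q(A) = 0, ker D̸_A ≠ 0 }`
   against `4/b = 0.444 (N_f = 3), 0.414 (N_f = 2)` (with the fluctuation bonus, against
   `(4 - b')/b`).  `κ₀ ≥ 4/b` (a theorem of analysis, no lattice) makes the early-crosser law an
   honest consequence of the dilute-gas accounting above; an explicit connection with `κ < (4-b')/b`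
   and a zero-mode pair is a blueprint for a lattice counterexample family (scale-`s_free…ρ_*`
   copies proliferate per physical volume like `a^{-(4-bκ-b')}`, contradicting (a′), (b″) and the
   continuation of Mohler–Schaefer's trend below 0.05 fm).  Minimisers solve a Dirac–Yang–Mills
   system `d_A* F = λ J(ψ)`, `D̸_Aψ = 0` (Seiberg–Witten-like); candidate test fields: the
   Sibner–Sibner–Uhlenbeck / Sadun–Segert non-self-dual Q = 0 Yang–Mills connections on S⁴.
   Secondary: NON-smooth carriers of intermediate size and Dirichlet-BOUNDARY-induced real
   eigenvalues of the cells ((a′) is about CELLS, the data about the TORUS) — the kit jobs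
   j009328/j009330 look at cells of side 4–6 cut from `8⁴` quenched configurations (kinetic floor
   `E₀`, min Re spec, real eigenvalues vs `|m_c|`).  No sub-threshold construction is known to this
   seat, and none is suggested by the literature read.
-/

/-! ## § 6  Numerics (kit; scripts `kit/cellspec.py`, `kit/qcells.py` in the seat folder; auto-attached to the item)

**E1 = j009326 (done, 1334 s, exit 0).**  Massless `r = 1` Wilson–Dirac DIRICHLET CELL (route `wilsonCell U 0 x s`,
tree conventions; self-checks: free periodic `5⁴` spectrum = `Σ(1−cos p) ± i|sin p|` to 2e-13; needle `1×1×1×6` all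
eigenvalues `4 ± 3e-3` (Jordan block)).  `edge = Σ_i(1 − cos(π/s_i))`.  A real eigenvalue `λ` = a crossing at `μ' = −λ`.

| links | cell `s` (interior) | dim | # real eig | real eigenvalues | min Re spec | edge |
|---|---|---|---|---|---|---|
| free | 3⁴ → (2⁴) | 64 | 0 | — | 2.500 | 2.000 |
| free | 4⁴ (3⁴) | 324 | 4 | 4.0000 ×4 (symmetry-pinned) | 1.615 | 1.172 |
| free | 5⁴ (4⁴) | 1024 | 0 | — | 1.139 | 0.764 |
| free | 6⁴ (5⁴) | 2500 | 4 | 4.0000 ×4 | 0.854 | 0.536 |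
| free | 7⁴ (6⁴) | 5184 | 0 | — | 0.670 | 0.396 |
| free | 14 non-cubic shapes `(3,3,3,5)…(6,6,6,7)`, `(2,·,·,·)` | ≤ 3000 | 0 (8 at 4.0 for the needle-like `(2,2,2,3)`) | — | 1.25–1.7 × edge | — |
| SU(3) noise ε = 0.05 / 0.2, `4⁴` | ×6 each | 972 | 12 (all at 4.000) | — | 1.61 / 1.67–1.69 | 1.172 |
| noise ε = 0.5, `4⁴` | ×6 | 972 | 12–16 | extra PAIRS at 2.85–3.8 (mirror 4.2–5.1) | 2.12–2.17 | 1.172 |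
| noise ε = 1.0, `4⁴` | ×6 | 972 | 16–36 | 2.43 … 5.57, none below 2.4 | 2.43–2.48 | 1.172 |
| noise ε = 0.2 / 0.5 / 1.0, `5⁴` | ×2 each | 3072 | 0 / 4 / 16–24 | — / 2.9–3.4 & mirror / 2.40 … 5.6 | 1.24 / 1.84 / 2.28 | 0.764 |
| Haar (β = 0), `3⁴` | ×400 | 192 | 0 in every sample | — | — | 2.000 |
| Haar, `4⁴` | ×40 | 972 | 23 on average, 100 % of samples | all in [2.25, 5.75], min 2.43 | — | 1.172 |
| Haar, `(3,3,3,5)` | ×100 | 384 | 8 on average, 95 % | all in [2.5, 5.5], min 2.56 | — | 1.691 |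

Readings.  (i) The FREE Dirichlet cell has NO real eigenvalue except the symmetry-pinned `λ = 4` of odd interiors
(crossing at `μ' = −4`, cf. § 4); its spectral left edge recedes only like `≈ 4.7/s^{1.5}` (`2.50, 1.62, 1.14, 0.85, 0.67`
for `s = 3…7`), 1.25–1.7 × the kinetic edge — the SF-type rigidity the mechanism presumes.  (ii) UV noise moves the
left edge UP (dressing: `1.61 → 1.67 → 2.13 → 2.45` at `s = 4` for `ε = 0.05 → 1`) and creates real eigenvalues only in
PAIRS in mid-band `[2.4, 5.6]` — crossings at `μ' ≤ −2.4`, deep below every honest line; chirality = 1/κ holds to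
two decimals on all non-degenerate real modes (route item ChiralityPairing, E3).  (iii) Even Haar links (β = 0, where
`m_c = −2`) give no real eigenvalue below 2.25 in cells of side ≤ 4: no early crosser relative to the strong-coupling
line either.  Nothing here bites (a′); everything is consistent with KineticEdge + dressing.

**E2 = j009328 (β_W = 6.0) and j009330 (β_W = 5.7): `8⁴` quenched Wilson action, 400 thermalisation + 25/config
Metropolis sweeps (6 hits, symmetric proposals, ≈50 % acceptance), ⟨plaq⟩ = 0.594 (6.0) / 0.547 (5.7) (literature 0.594 /
0.549); both jobs were cut by the scheduler's 0.5 h cap after 3 configurations — 15 + 13 cells.  `|m_c|` = 0.819 (6.0),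
1.048 (5.7).**

| β_W | cell `s` | edge | `E₀` (cell ½∇_U†∇_U) | min Re spec | min Re − edge | `E₀` − edge | # real eig | real eig `< 3` | `< |m_c|` |
|---|---|---|---|---|---|---|---|---|---|
| 6.0 | 4 (×6) | 1.172 | 1.37–1.39 | 1.81–1.89 | 0.64–0.72 | 0.19–0.21 | 12–14 | none | 0 |
| 6.0 | 5 (×6) | 0.764 | 1.03–1.05 | 1.50–1.54 | 0.74–0.77 | 0.27–0.29 | 0 | none | 0 |
| 6.0 | 6 (×3) | 0.536 | 0.86–0.88 | 1.31–1.35 | 0.77–0.81 | 0.32–0.34 | 12–14 | none | 0 |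
| 5.7 | 4 (×6) | 1.172 | 1.41–1.45 | 1.88–1.97 | 0.71–0.80 | 0.24–0.28 | 12 | none | 0 |
| 5.7 | 5 (×5) | 0.764 | 1.08–1.12 | 1.58–1.66 | 0.82–0.90 | 0.32–0.36 | 0 | none | 0 |
| 5.7 | 6 (×2) | 0.536 | 0.92–0.94 | 1.45–1.47 | 0.91–0.93 | 0.39–0.41 | 14–24 | 1.90, 2.08, 2.86, 2.93 | 0 |

Readings.  (i) The left edge of the CELL spectrum of `B_U` sits at `≈ |m_c(β)| + edge(s)` and approaches it from below as
`s` grows (6.0: 0.67 → 0.75 → 0.79 vs 0.82; 5.7: 0.76 → 0.86 → 0.92 vs 1.05): the extended spectrum IS dressed by the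
critical mass, configuration by configuration, as the mechanism presumes.  (ii) The kinetic floor of the covariant
Laplacian is dressed much less (`E₀ − edge ≈ 0.2–0.4`), so the kinematic window `[E₀, |m_c| − h]` of § 5 item 1 is
≈ 0.5–0.65 wide and OPEN in every cell of side ≥ 5 — yet it is EMPTY: no real eigenvalue below `|m_c|` in any of the 28
cells, none below 3 at β_W = 6.0 at all.  (iii) At β_W = 5.7 the `6⁴` cells begin to show real modes below the
mid-band, at `λ = 1.90, 2.08` (crossings at `μ' ≈ −2`): Edwards–Heller–Narayanan's region II (`1.02 < −μ' < 2` at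
β = 5.7) seen from its deep end — LATE crossers by ≈ 0.85, i.e. the dislocation population whose modes sit far below the
line; as β grows they recede (none at 6.0), exactly the finite-β phenomenon of § 5 item 2.  Nothing bites (a′); every
number is consistent with KineticEdge + dressing + "real modes are mid-band pairs or deep dislocation modes".
-/

end Summit.QuantumFields.QCD.Cruxes.EarlyCrosserLaw.Disproof

end
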